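import Summits.CriticalPhenomena.PercolationContinuityZ3.Theorems.SoloInformedCubeLemma
import HarnessLib

/-!
# The cube face: `θ(p_c) = 0` on `ℤ^d` from crossings of ONE near-cube bounded away from one
(solo seat `solo-CriticalPhenomena-informed`, paper §7 row (Q) / §7b.3 (d6))

Fix `r ≥ 1`.  For a mesh `u ≥ 1` the **near-cube** `Q_{u,r}` is the central slab
`{u ≤ x_0 ≤ (r+1)u}` of the cube `[0, (r+2)u]^d`: a brick of thickness `r u` and cross-section
`((r+2)u)^{d-1}`, i.e. of aspect ratio `r : (r+2) : ⋯ : (r+2)` — as close to a cube as one likes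
for `r` large.  `slabCrossing u r k g` is the event that the translate by `u g` of this brick (thin
direction `k`) is crossed by an open path IN ITS THIN DIRECTION, inside the brick.

* `boxCrossing_subset_iUnion_slabCrossing` — **composition**: with `m = (r+1)u`, an open path from
  `Λ(m)` to `∂ⁱⁿΛ(2m)` inside `Λ(2m)` crosses, in its thin direction, one of the bricks
  `u g + Q_{u,r}` (direction `k`, `g ∈ Λ(2r+2)`) — a family of `d (4r+5)^d` bricks, a number
  INDEPENDENT of the mesh `u`.  (Proof: the cube lemma `exists_cubeCross_of_walk` gives a
  face-to-opposite-face crossing of a cube `a₀ + [0,m]^d ⊆ Λ(2m)`; the brick of the `u`-grid just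
  below `a₀` contains that cube's central part, and two first-exit cuts trim the crossing.)
* `real_boxCrossing_le_of_slabCrossing` — **Harris**: if every brick of the family is blocked
  (not thin-crossed) with probability `≥ c`, then `P_p(Λ(m) ↔ ∂ⁱⁿΛ(2m) in Λ(2m)) ≤ 1 - c^K`,
  `K = d (4r+5)^d`.
* `real_slabCrossing_eq` — **symmetry**: all bricks of the family have the same crossing
  probability (translation and a coordinate transposition).
* `percolationContinuity_of_slabCrossing_le`, `percolationContinuityZ3_of_slabCrossing_le` —
  **the cube face**: if for some `r ≥ 1`, `c > 0` and infinitely many meshes `u` the near-cube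
  `Q_{u,r} = [u,(r+1)u] × [0,(r+2)u]^{d-1}` is crossed in its thin direction at `p_c` with
  probability at most `1 - c`, then `θ(p_c) = 0` (via the annulus entrance
  `percolationContinuity_of_boxCrossing_le`).

Compared with the slab-box face (`SoloInformedSlabBoxFace`, aspect `1 : 3`), the hypothesis here
is on a brick of aspect `r : (r+2)`, arbitrarily close to a cube: numerically the thin-blocking
probability of the `1 : 3` box at `p_c(ℤ³)` is `≈ 0.0025` while that of a cube is `≈ 0.7`, and in
the (conjecturally impossible) world `θ(p_c) > 0` the crossing probability of every brick of
bounded aspect tends to one; so the face isolates exactly the missing input — a uniform lower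
bound for closed separating surfaces in a near-cube at `p_c`, an `ε`-Russo–Seymour–Welsh
statement for critical surfaces in `d = 3`.  The exact cube (`r : r`) is NOT reached by this
composition: a diagonal staircase crosses no cube of a FIXED grid from a face to the opposite
face, so a bounded family of exact cubes cannot be forced, and the margin `u` (aspect
`r : (r+2)`) is the price of rounding the cube of the cube lemma to the `u`-grid.  Conversely the
theorem shows, by contraposition and at any `p` (the annulus entrance only uses independence of
disjoint annuli), that `θ > 0` forces the thin-crossing probability of every near-cube of bounded
aspect to tend to one — an elementary fact here, recorded at `p_c` only.  Numerically the crossing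
probability of an `L × L × L'` box at `p_c(ℤ³)` is a universal function of `L'/L` strictly between
`0` and `1` (Lorenz–Ziff 1998, J. Phys. A 31, 8147, §4), which is what the hypothesis asks to
prove for one aspect ratio. Elementary given Harris' inequality. [folklore]
-/

noncomputable section

namespace Summit.CriticalPhenomena.PercolationContinuityZ3.Theorems

open MeasureTheory ProbabilityTheory Filter Topology
open Literature.Probability.Percolation Literature.Probability.LatticeModels
open Literature.Probability.Percolation.CerfDembinVanishing
open scoped ENNReal

namespace SurfaceTension

variable {d : ℕ}

/-! ## Near-cubes and their thin crossings -/

/-- The near-cube `u g + Q_{u,r}`: the cube `u g + [0,(r+2)u]^d` with its `k`-th coordinate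
restricted to the central slab `[u g_k + u, u g_k + (r+1)u]`. -/
def midSlab (u r : ℕ) (k : Fin d) (g : Site d) : Set (Site d) :=
  {x | (∀ j, (u : ℤ) * g j ≤ x j ∧ x j ≤ (u : ℤ) * g j + (r + 2) * u) ∧
    (u : ℤ) * g k + u ≤ x k ∧ x k ≤ (u : ℤ) * g k + (r + 1) * u}

/-- The lower large face `{x_k = u g_k + u}` of the near-cube. -/
def loFace (u r : ℕ) (k : Fin d) (g : Site d) : Set (Site d) :=
  {x | x ∈ midSlab u r k g ∧ x k = (u : ℤ) * g k + u}

/-- The upper large face `{x_k = u g_k + (r+1)u}` of the near-cube. -/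
def hiFace (u r : ℕ) (k : Fin d) (g : Site d) : Set (Site d) :=
  {x | x ∈ midSlab u r k g ∧ x k = (u : ℤ) * g k + (r + 1) * u}

/-- The event "the near-cube `u g + Q_{u,r}` (thin direction `k`) is crossed by an open path in
its thin direction, inside itself". -/
def slabCrossing (u r : ℕ) (k : Fin d) (g : Site d) : Set (BondConfig (Site d)) :=
  linked (midSlab u r k g) (loFace u r k g) (hiFace u r k g)

/-- `slabCrossing` is increasing. -/
theorem isUpperSet_slabCrossing (u r : ℕ) (k : Fin d) (g : Site d) :
    IsUpperSet (slabCrossing u r k g) :=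
  isUpperSet_linked _ _ _

/-- `slabCrossing` is measurable. -/
theorem measurableSet_slabCrossing (u r : ℕ) (k : Fin d) (g : Site d) :
    MeasurableSet (slabCrossing u r k g) :=
  measurableSet_linked _ _ _

/-! ## The composition lemma -/

/-- **Composition lemma.** With `m = (r+1)u` (`u, r ≥ 1`), an open path from `Λ(m)` to `∂ⁱⁿΛ(2m)`
inside `Λ(2m)` crosses one of the near-cubes `u g + Q_{u,r}`, `g ∈ Λ(2r+2)`, in its thin
direction. -/
theorem boxCrossing_subset_iUnion_slabCrossing {u r : ℕ} (hu : 1 ≤ u) (hr : 1 ≤ r) :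
    boxCrossing d ((r + 1) * u) (2 * ((r + 1) * u)) ⊆
      ⋃ k : Fin d, ⋃ g ∈ box d (2 * r + 2), slabCrossing u r k g := by
  intro ω hω
  set m : ℕ := (r + 1) * u with hm
  have hm1 : 1 ≤ m := le_trans hu (Nat.le_mul_of_pos_left u (Nat.succ_pos r))
  rw [boxCrossing_eq_linked, mem_linked_iff] at hω
  obtain ⟨b, hb, a, ha, hab⟩ := hω
  rw [Finset.mem_coe] at ha hb
  have hbB : b ∈ box d (2 * m) := (mem_innerBoundary_iff.1 hb).1
  have haB : a ∈ box d (2 * m) := box_mono d (by omega) ha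
  obtain ⟨i, hi⟩ := exists_eq_of_mem_innerBoundary_box hb
  push_cast at hi
  rw [mem_inConn_iff] at hab
  obtain ⟨W⟩ := hab
  set H := openGraph ω ⊓ withinGraph (zdGraph d) ↑(box d (2 * m)) with hH
  have hHle : H ≤ withinGraph (zdGraph d) ↑(box d (2 * m)) := inf_le_right
  -- Step 1: a face-to-opposite-face crossing of a cube `a₀ + [0,m]^d ⊆ Λ(2m)`
  obtain ⟨a₀, k, x, y, ha₀, hx, hxk, hy, hyk, hreach⟩ : ∃ (a₀ : Site d) (k : Fin d) (x y : Site d),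
      (∀ j, ∃ z ∈ (↑(box d (2 * m)) : Set (Site d)), a₀ j = z j) ∧
      x ∈ cube a₀ m ∧ x k = a₀ k ∧ y ∈ cube a₀ m ∧ y k = a₀ k + m ∧
      (H ⊓ withinGraph (zdGraph d) (cube a₀ m)).Reachable x y := by
    have hai := (mem_box.1 ha) i
    rcases hi with hi | hi
    · exact exists_cubeCross_of_walk hHle (Finset.mem_coe.2 haB) W.reverse hm1 (k := i)
        (by omega)
    · exact exists_cubeCross_of_walk hHle (Finset.mem_coe.2 hbB) W hm1 (k := i)
        (by omega)
  -- the corner lies in `Λ(2m)`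
  have ha₀B : ∀ j, -(2 * m : ℤ) ≤ a₀ j ∧ a₀ j ≤ 2 * m := by
    intro j
    obtain ⟨z, hz, hzj⟩ := ha₀ j
    have := (mem_box.1 (Finset.mem_coe.1 hz)) j
    push_cast at this
    rw [hzj]
    exact this
  -- Step 2: the `u`-grid brick just below `a₀`
  have hu0 : (0 : ℤ) < u := by exact_mod_cast hu
  let g : Site d := fun j => a₀ j / (u : ℤ)
  have hg : ∀ j, (u : ℤ) * g j ≤ a₀ j ∧ a₀ j < (u : ℤ) * g j + u := by
    intro j
    have h1 := Int.mul_ediv_add_emod (a₀ j) (u : ℤ)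
    have h2 := Int.emod_nonneg (a₀ j) hu0.ne'
    have h3 := Int.emod_lt_of_pos (a₀ j) hu0
    constructor <;> simp only [g] <;> omega
  have hmZ : (m : ℤ) = (r + 1) * u := by rw [hm]; push_cast; ring
  have hgbox : g ∈ box d (2 * r + 2) := by
    rw [mem_box]
    intro j
    push_cast
    have h1 : (u : ℤ) * g j ≤ (u : ℤ) * (2 * r + 2) := by nlinarith [(hg j).1, (ha₀B j).2]
    have h2 : (u : ℤ) * (-(2 * r + 2)) < (u : ℤ) * (g j + 1) := by
      nlinarith [(hg j).2, (ha₀B j).1]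
    exact ⟨by linarith [lt_of_mul_lt_mul_left h2 hu0.le], le_of_mul_le_mul_left h1 hu0⟩
  -- the two cutting heights
  set lo : ℤ := (u : ℤ) * g k + u with hlo
  set hi : ℤ := (u : ℤ) * g k + (r + 1) * u with hhi
  have hlo1 : a₀ k < lo := (hg k).2
  have hlohi : lo < hi := by
    have : (u : ℤ) < (r + 1) * u := by nlinarith
    linarith
  have hhi1 : hi ≤ a₀ k + m := by rw [hmZ]; linarith [(hg k).1]
  have hmem : ∀ z, z ∈ cube a₀ m → lo ≤ z k → z k ≤ hi → z ∈ midSlab u r k g := by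
    intro z hz h1 h2
    refine ⟨fun j => ⟨le_trans (hg j).1 (hz j).1, ?_⟩, h1, h2⟩
    have := (hz j).2
    have := (hg j).2
    rw [hmZ] at *
    linarith
  -- Step 3: first cut, at height `hi`
  set G' := H ⊓ withinGraph (zdGraph d) (cube a₀ m) with hG'
  have hG'le : G' ≤ zdGraph d := inf_le_right.trans (withinGraph_le _ _)
  obtain ⟨W₁⟩ := hreach
  set R₁ : Set (Site d) := {z | z k < hi} with hR₁
  have hxR₁ : x ∈ R₁ := by simp only [hR₁, Set.mem_setOf_eq, hxk]; linarith
  have hyR₁ : y ∉ R₁ := by simp only [hR₁, Set.mem_setOf_eq, hyk, not_lt]; exact hhi1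
  obtain ⟨b₁, c₁, hb₁, hc₁, hadj₁, hreach₁⟩ := exists_exit_of_walk hG'le R₁ W₁ hxR₁ hyR₁
  simp only [hR₁, Set.mem_setOf_eq, not_lt] at hb₁ hc₁
  have hc₁k : c₁ k = hi := by
    have := (coord_sub_le_one_of_adj (hG'le hadj₁) k).2
    linarith
  have hc₁Q : c₁ ∈ cube a₀ m :=
    (withinGraph_adj.1 ((SimpleGraph.inf_adj _ _ _ _).1 hadj₁).2).2.2
  set G'' := G' ⊓ withinGraph (zdGraph d) {z | z k ≤ hi} with hG''
  have hG''le : G'' ≤ zdGraph d := inf_le_left.trans hG'le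
  have hreach₁' : G''.Reachable x c₁ := by
    have hle : G' ⊓ withinGraph (zdGraph d) R₁ ≤ G'' := by
      intro z w hzw
      rw [SimpleGraph.inf_adj, withinGraph_adj] at hzw ⊢
      exact ⟨hzw.1, hzw.2.1, le_of_lt (show z k < hi from hzw.2.2.1),
        le_of_lt (show w k < hi from hzw.2.2.2)⟩
    have hK : G''.Adj b₁ c₁ := by
      rw [hG'', SimpleGraph.inf_adj, withinGraph_adj]
      exact ⟨hadj₁, hG'le hadj₁, hb₁.le, hc₁k.le⟩
    exact (hreach₁.mono hle).trans hK.reachable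
  -- Step 4: second cut, backwards from `c₁`, at height `lo`
  obtain ⟨W₂⟩ := hreach₁'.symm
  set R₂ : Set (Site d) := {z | lo < z k} with hR₂
  have hcR₂ : c₁ ∈ R₂ := by simp only [hR₂, Set.mem_setOf_eq, hc₁k]; exact hlohi
  have hxR₂ : x ∉ R₂ := by simp only [hR₂, Set.mem_setOf_eq, hxk, not_lt]; exact hlo1.le
  obtain ⟨b₂, c₂, hb₂, hc₂, hadj₂, hreach₂⟩ := exists_exit_of_walk hG''le R₂ W₂ hcR₂ hxR₂
  simp only [hR₂, Set.mem_setOf_eq, not_lt] at hb₂ hc₂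
  have hc₂k : c₂ k = lo := by
    have := (coord_sub_le_one_of_adj (hG''le hadj₂) k).1
    linarith
  have hadj₂' : G'.Adj b₂ c₂ := ((SimpleGraph.inf_adj _ _ _ _).1 hadj₂).1
  have hc₂Q : c₂ ∈ cube a₀ m :=
    (withinGraph_adj.1 ((SimpleGraph.inf_adj _ _ _ _).1 hadj₂').2).2.2
  have hc₂hi : c₂ k ≤ hi := (withinGraph_adj.1 ((SimpleGraph.inf_adj _ _ _ _).1 hadj₂).2).2.2
  -- Step 5: the trimmed path lies in the brick
  have hle : G'' ⊓ withinGraph (zdGraph d) R₂ ≤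
      openGraph ω ⊓ withinGraph (zdGraph d) (midSlab u r k g) := by
    intro z w hzw
    rw [SimpleGraph.inf_adj, withinGraph_adj, hG'', SimpleGraph.inf_adj, withinGraph_adj, hG',
      SimpleGraph.inf_adj, withinGraph_adj, hH, SimpleGraph.inf_adj] at hzw
    obtain ⟨⟨⟨⟨ho, -⟩, hG, hzQ, hwQ⟩, -, hzhi, hwhi⟩, -, hzR, hwR⟩ := hzw
    rw [SimpleGraph.inf_adj, withinGraph_adj]
    exact ⟨ho, hG, hmem z hzQ (le_of_lt (show lo < z k from hzR)) hzhi,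
      hmem w hwQ (le_of_lt (show lo < w k from hwR)) hwhi⟩
  have hK : (openGraph ω ⊓ withinGraph (zdGraph d) (midSlab u r k g)).Adj b₂ c₂ := by
    have h1 := (SimpleGraph.inf_adj _ _ _ _).1 hadj₂
    have h2 := (SimpleGraph.inf_adj _ _ _ _).1 h1.1
    have h3 := (SimpleGraph.inf_adj _ _ _ _).1 h2.1
    have hb₂Q : b₂ ∈ cube a₀ m := (withinGraph_adj.1 h2.2).2.1
    have hb₂hi : b₂ k ≤ hi := (withinGraph_adj.1 h1.2).2.1
    rw [SimpleGraph.inf_adj, withinGraph_adj]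
    exact ⟨h3.1, hG''le hadj₂, hmem b₂ hb₂Q hb₂.le hb₂hi, hmem c₂ hc₂Q hc₂k.ge hc₂hi⟩
  have hfinal : (openGraph ω ⊓ withinGraph (zdGraph d) (midSlab u r k g)).Reachable c₂ c₁ :=
    ((hreach₂.mono hle).trans hK.reachable).symm
  refine Set.mem_iUnion.2 ⟨k, Set.mem_iUnion₂.2 ⟨g, hgbox, mem_linked_iff.2
    ⟨c₂, ⟨hmem c₂ hc₂Q hc₂k.ge hc₂hi, hc₂k⟩, c₁, ⟨hmem c₁ hc₁Q (hlohi.le.trans hc₁k.ge) hc₁k.le,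
      hc₁k⟩, mem_inConn_iff.2 hfinal⟩⟩⟩

/-! ## Harris–FKG over the family of bricks -/

/-- **Blocking all bricks blocks the annulus.** If every near-cube `u g + Q_{u,r}`
(`k` any direction, `g ∈ Λ(2r+2)`) fails to be thin-crossed with probability at least `c ≥ 0`, then
`P_p(Λ(m) ↔ ∂ⁱⁿΛ(2m) in Λ(2m)) ≤ 1 - c^K` with `m = (r+1)u` and `K = d · #Λ(2r+2)`. -/
theorem real_boxCrossing_le_of_slabCrossing (p : unitInterval) {u r : ℕ} (hu : 1 ≤ u) (hr : 1 ≤ r)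
    {c : ℝ} (hc : 0 ≤ c)
    (h : ∀ (k : Fin d) (g : Site d), g ∈ box d (2 * r + 2) →
      c ≤ 1 - (bondPercolation (zdGraph d) p).real (slabCrossing u r k g)) :
    (bondPercolation (zdGraph d) p).real (boxCrossing d ((r + 1) * u) (2 * ((r + 1) * u))) ≤
      1 - c ^ ((Finset.univ : Finset (Fin d)) ×ˢ box d (2 * r + 2)).card := by
  classical
  set μ := bondPercolation (zdGraph d) p with hμ
  set s : Finset (Fin d × Site d) := (Finset.univ : Finset (Fin d)) ×ˢ box d (2 * r + 2) with hs
  let A : Fin d × Site d → Set (BondConfig (Site d)) := fun q => (slabCrossing u r q.1 q.2)ᶜ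
  have hAm : ∀ q ∈ s, MeasurableSet (A q) :=
    fun q _ => (measurableSet_slabCrossing u r q.1 q.2).compl
  have hAl : ∀ q ∈ s, IsLowerSet (A q) :=
    fun q _ => (isUpperSet_slabCrossing u r q.1 q.2).compl
  have hAc : ∀ q ∈ s, c ≤ μ.real (A q) := by
    intro q hq
    change c ≤ μ.real (slabCrossing u r q.1 q.2)ᶜ
    rw [probReal_compl_eq_one_sub (measurableSet_slabCrossing u r q.1 q.2)]
    exact h q.1 q.2 (Finset.mem_product.1 hq).2
  have hprod : c ^ s.card ≤ μ.real (⋂ q ∈ s, A q) := by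
    calc c ^ s.card = ∏ _q ∈ s, c := by rw [Finset.prod_const]
      _ ≤ ∏ q ∈ s, μ.real (A q) := Finset.prod_le_prod (fun _ _ => hc) hAc
      _ ≤ μ.real (⋂ q ∈ s, A q) := prob_biInter_ge_prod_of_isLowerSet (zdGraph d) p _ A hAl hAm
  have hsub : (⋂ q ∈ s, A q) ⊆ (boxCrossing d ((r + 1) * u) (2 * ((r + 1) * u)))ᶜ := by
    intro ω hω hcross
    obtain ⟨k, hk⟩ := Set.mem_iUnion.1 (boxCrossing_subset_iUnion_slabCrossing hu hr hcross)
    obtain ⟨g, hg, hkg⟩ := Set.mem_iUnion₂.1 hk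
    have := (Set.mem_iInter₂.1 hω) (k, g) (Finset.mem_product.2 ⟨Finset.mem_univ _, hg⟩)
    exact this hkg
  have hcompl : μ.real (boxCrossing d ((r + 1) * u) (2 * ((r + 1) * u)))ᶜ =
      1 - μ.real (boxCrossing d ((r + 1) * u) (2 * ((r + 1) * u))) :=
    probReal_compl_eq_one_sub (measurableSet_boxCrossing _ _)
  have := (hprod.trans (measureReal_mono hsub)).trans_eq hcompl
  linarith

/-! ## All bricks of the family are alike -/

/-- Translation: the brick `u g + Q_{u,r}` has the crossing probability of `Q_{u,r}`. -/
theorem real_slabCrossing_eq_zero (p : unitInterval) (u r : ℕ) (k : Fin d) (g : Site d) :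
    (bondPercolation (zdGraph d) p).real (slabCrossing u r k g) =
      (bondPercolation (zdGraph d) p).real (slabCrossing u r k 0) := by
  set v : Site d := fun j => (u : ℤ) * g j with hv
  set φ : zdGraph d ≃g zdGraph d := zdShiftIso v with hφ
  have key : ∀ (x : Site d) (j : Fin d), (φ x) j = x j + (u : ℤ) * g j := fun x j => by
    simp [hφ, hv]
  have hS : ∀ x : Site d, x ∈ midSlab u r k 0 ↔ φ x ∈ midSlab u r k g := fun x => by
    simp only [midSlab, Set.mem_setOf_eq, key, Pi.zero_apply, mul_zero, zero_add]
    refine ⟨fun h => ⟨fun j => ⟨by linarith [(h.1 j).1], by linarith [(h.1 j).2]⟩,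
      by linarith [h.2.1], by linarith [h.2.2]⟩, fun h => ⟨fun j => ⟨by linarith [(h.1 j).1],
      by linarith [(h.1 j).2]⟩, by linarith [h.2.1], by linarith [h.2.2]⟩⟩
  have hSim : (φ.toEquiv : Site d ≃ Site d) '' midSlab u r k 0 = midSlab u r k g :=
    image_eq_of_forall_iff φ.toEquiv hS
  have hLim : (φ.toEquiv : Site d ≃ Site d) '' loFace u r k 0 = loFace u r k g :=
    image_eq_of_forall_iff φ.toEquiv fun x => by
      simp only [loFace, Set.mem_setOf_eq, hS, Pi.zero_apply, mul_zero, zero_add]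
      exact and_congr_right fun _ => by
        rw [show ((φ.toEquiv : Site d ≃ Site d) x) k = (φ x) k from rfl, key]; constructor <;>
          intro h <;> linarith
  have hHim : (φ.toEquiv : Site d ≃ Site d) '' hiFace u r k 0 = hiFace u r k g :=
    image_eq_of_forall_iff φ.toEquiv fun x => by
      simp only [hiFace, Set.mem_setOf_eq, hS, Pi.zero_apply, mul_zero, zero_add]
      exact and_congr_right fun _ => by
        rw [show ((φ.toEquiv : Site d ≃ Site d) x) k = (φ x) k from rfl, key]; constructor <;>
          intro h <;> linarith
  have himg := real_linked_image φ p (midSlab u r k 0) (loFace u r k 0) (hiFace u r k 0)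
  rw [slabCrossing, slabCrossing, ← himg]
  change _ = (bondPercolation (zdGraph d) p).real
      (linked ((φ.toEquiv : Site d ≃ Site d) '' midSlab u r k 0)
        ((φ.toEquiv : Site d ≃ Site d) '' loFace u r k 0)
        ((φ.toEquiv : Site d ≃ Site d) '' hiFace u r k 0))
  rw [hSim, hLim, hHim]

/-- **Symmetry.** All bricks of the family have the same thin-crossing probability: a translation
and a transposition of coordinates map `u g + Q_{u,r}` (direction `k`) with its faces onto
`Q_{u,r}` (direction `k₀`) with its faces. -/
theorem real_slabCrossing_eq (p : unitInterval) (u r : ℕ) (k k₀ : Fin d) (g : Site d) :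
    (bondPercolation (zdGraph d) p).real (slabCrossing u r k g) =
      (bondPercolation (zdGraph d) p).real (slabCrossing u r k₀ 0) := by
  rw [real_slabCrossing_eq_zero]
  set φ : zdGraph d ≃g zdGraph d := zdSignedPermIso (Equiv.swap k k₀) (fun _ => 1) with hφ
  have key : ∀ (x : Site d) (j : Fin d), (φ x) j = x (Equiv.swap k k₀ j) := fun x j => by
    simp [hφ, Equiv.symm_swap]
  have hS : ∀ x : Site d, x ∈ midSlab u r k 0 ↔ φ x ∈ midSlab u r k₀ 0 := fun x => by
    simp only [midSlab, Set.mem_setOf_eq, key, Pi.zero_apply, mul_zero, zero_add,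
      Equiv.swap_apply_right]
    exact and_congr_left fun _ => ⟨fun h j => h _, fun h j => by
      simpa [Equiv.swap_apply_self] using h (Equiv.swap k k₀ j)⟩
  have hSim : (φ.toEquiv : Site d ≃ Site d) '' midSlab u r k 0 = midSlab u r k₀ 0 :=
    image_eq_of_forall_iff φ.toEquiv hS
  have hLim : (φ.toEquiv : Site d ≃ Site d) '' loFace u r k 0 = loFace u r k₀ 0 :=
    image_eq_of_forall_iff φ.toEquiv fun x => by
      simp only [loFace, Set.mem_setOf_eq, hS, Pi.zero_apply, mul_zero, zero_add]
      exact and_congr_right fun _ => by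
        rw [show ((φ.toEquiv : Site d ≃ Site d) x) k₀ = (φ x) k₀ from rfl, key,
          Equiv.swap_apply_right]
  have hHim : (φ.toEquiv : Site d ≃ Site d) '' hiFace u r k 0 = hiFace u r k₀ 0 :=
    image_eq_of_forall_iff φ.toEquiv fun x => by
      simp only [hiFace, Set.mem_setOf_eq, hS, Pi.zero_apply, mul_zero, zero_add]
      exact and_congr_right fun _ => by
        rw [show ((φ.toEquiv : Site d ≃ Site d) x) k₀ = (φ x) k₀ from rfl, key,
          Equiv.swap_apply_right]
  have himg := real_linked_image φ p (midSlab u r k 0) (loFace u r k 0) (hiFace u r k 0)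
  rw [slabCrossing, slabCrossing, ← himg]
  change (bondPercolation (zdGraph d) p).real
      (linked ((φ.toEquiv : Site d ≃ Site d) '' midSlab u r k 0)
        ((φ.toEquiv : Site d ≃ Site d) '' loFace u r k 0)
        ((φ.toEquiv : Site d ≃ Site d) '' hiFace u r k 0)) = _
  rw [hSim, hLim, hHim]

/-! ## The cube face -/

/-- **The cube face.** Fix a direction `k₀`, an integer `r ≥ 1` and `c > 0`. If for infinitely
many meshes `u` the near-cube `Q_{u,r} = {u ≤ x_{k₀} ≤ (r+1)u} ∩ [0,(r+2)u]^d` — a brick of aspect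
ratio `r : (r+2) : ⋯ : (r+2)` — is crossed by an open path in its thin direction `k₀`, inside
itself, at `p_c` with probability at most `1 - c`, then `θ(p_c) = 0` on `ℤ^d`. -/
theorem percolationContinuity_of_slabCrossing_le (k₀ : Fin d) {r : ℕ} (hr : 1 ≤ r) {c : ℝ}
    (hc : 0 < c)
    (h : ∃ᶠ u in atTop,
      (bondPercolation (zdGraph d) (criticalProbI d)).real (slabCrossing u r k₀ 0) ≤ 1 - c) :
    PercolationContinuity d := by
  refine percolationContinuity_of_boxCrossing_le
    (δ := c ^ ((Finset.univ : Finset (Fin d)) ×ˢ box d (2 * r + 2)).card) (by positivity)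
    fun M => ?_
  obtain ⟨u, hu, huM⟩ := (h.and_eventually (eventually_ge_atTop (max M 1))).exists
  have hu1 : 1 ≤ u := (le_max_right M 1).trans huM
  refine ⟨(r + 1) * u, 2 * ((r + 1) * u),
    ((le_max_left M 1).trans huM).trans (Nat.le_mul_of_pos_left u (Nat.succ_pos r)),
    by omega, ?_⟩
  exact real_boxCrossing_le_of_slabCrossing (criticalProbI d) hu1 hr hc.le fun k g _ => by
    rw [real_slabCrossing_eq (criticalProbI d) u r k k₀ g]; linarith

/-- **The cube face on `ℤ³`.** If for some `r ≥ 1` and `c > 0` the brick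
`[u, (r+1)u] × [0, (r+2)u]²` (aspect `r : (r+2) : (r+2)`, as close to a cube as desired) is
crossed by an open path from `{x₀ = u}` to `{x₀ = (r+1)u}` inside the brick at `p_c(ℤ³)` with
probability at most `1 - c` for infinitely many `u` — equivalently, a closed dual surface inside
the brick separates its two large faces with probability at least `c` — then `θ(p_c) = 0` on
`ℤ³`. -/
theorem percolationContinuityZ3_of_slabCrossing_le {r : ℕ} (hr : 1 ≤ r) {c : ℝ} (hc : 0 < c)
    (h : ∃ᶠ u in atTop,
      (bondPercolation (zdGraph 3) (criticalProbI 3)).real (slabCrossing u r (0 : Fin 3) 0) ≤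
        1 - c) :
    PercolationContinuityZ3 :=
  percolationContinuity_of_slabCrossing_le 0 hr hc h

end SurfaceTension

end Summit.CriticalPhenomena.PercolationContinuityZ3.Theorems

end
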